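import Mathlib
import Literature.Topology.FourManifolds.Handles
import Literature.Topology.FourManifolds.Gluing
import Literature.Geometry.Symplectic.SteinDomain
import HarnessLib

/-!
# MazurDouble

Topic `Literature/Topology/FourManifolds`. Named literature fact(s) relocated by the gate from `Summits/SmoothPoincare4/SmoothPoincare4/Theorems/ConvexBisectionAcyclicBisectionRigidityStubMazurDouble.lean`
(accept-time relocation of `[cite]`d propositions written inline in a Summits proposal; human ruling 2026-08-15).
Sources: AitchisonRubinstein1984, Mazur1961.

* `Literature.Topology.FourManifolds.Mazur1961_double_sphere_four`
-/

namespace Literature.Topology.FourManifolds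

open scoped Manifold ContDiff Topology ContinuousMap
open Set Function Literature.Topology.FourManifolds Literature.Geometry.Symplectic

/-- **Mazur doubles are standard (Mazur 1961; Aitchison–Rubinstein 1984, Lemma 5.4: "Let `M⁴` be a
Mazur manifold. Then `M⁴ ∪_id M⁴ ≅ S⁴`").**  A *Mazur manifold* is a compact contractible smooth
`4`-manifold with a handle decomposition `H⁰ ∪ H¹ ∪ H²` (one handle of each index `0, 1, 2`; the
attaching circle of `H²` is then homotopic to the generator of `π₁(S¹ × S²) = π₁ ∂(H⁰ ∪ H¹)`).  Its
double `D(W) = W ∪_id W` is diffeomorphic to `S⁴`: Mazur's proof — in `∂(S¹ × B⁴)` the attaching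
circle is isotopic to `S¹ × pt` (homotopy implies isotopy for circles in a `4`-manifold), so the
`1`- and `2`-handle of `W × I` cancel, `W × I ≅ B⁵`, and `D(W) = ∂(W × I) ≅ S⁴`; Aitchison–Rubinstein
give a 4-dimensional proof (`H² ∪ H̄² = S² × D²`, `S¹ × B³` unknots in `S¹ × S³`, Laudenbach–Poénaru).
In the tree's vocabulary: `W` compact Hausdorff second countable modelled on `𝓡∂ 4`, contractible,
with `HasHandleDecomposition 3 W (1,1,1,0,…)` (an adapted Morse function with exactly one critical
point of each index `0, 1, 2` and none of index `≥ 3`, Milnor 1963 Thm. 3.2 / Kosinski VII §2 reading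
of the handle structure); `b` a boundary datum; `P` a Hausdorff second-countable smooth `4`-manifold
with `IsDouble b (𝓡 4) P` (`Gluing.lean`); then `P ≅ S⁴`.  Absent from Mathlib and from the tree
(no product-with-corners `W × I`, `DoubleThickening.lean`; the `r = 1` cancellation in dimension `5`
is the named fact `IsPresentationHandlebodyFive.nonempty_diffeomorph_closedBall_of_isStablyAndrewsCurtisEquivalent`);
reduced to those inputs in the lead folder's `work/stubs/stub_mazurDouble.lean` (`Mazur1961_double_sphere_four_of_facts`: a COUNTED thickening fact + the rank-one Andrews–Curtis triviality, proved there).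
See also Akbulut–Kirby, *Mazur manifolds*, Michigan Math. J. 26 (1979) (the class of Mazur manifolds) and
Gompf–Stipsicz (1999), §4.6, §5.1 (doubles as `∂(W × I)`, 5-dimensional handle moves).
[cite: AitchisonRubinstein1984, Lemma 5.4] [cite: Mazur1961, Theorem (W × I ≅ I⁵) and its Corollary (2W ≅ S⁴)]
[file Topology/FourManifolds/MazurDouble] -/
def Mazur1961_double_sphere_four : Prop :=
  ∀ (W : Type) [TopologicalSpace W] [T2Space W] [SecondCountableTopology W]
    [ChartedSpace (EuclideanHalfSpace 4) W] [IsManifold (𝓡∂ 4) ∞ W] [CompactSpace W]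
    [ContractibleSpace W],
    HasHandleDecomposition 3 W (fun k => if k ≤ 2 then 1 else 0) →
    ∀ (b : BoundaryData (𝓡∂ 4) W (𝓡 3))
      (P : Type) [TopologicalSpace P] [T2Space P] [SecondCountableTopology P]
      [ChartedSpace (EuclideanSpace ℝ (Fin 4)) P] [IsManifold (𝓡 4) ∞ P],
    IsDouble b (𝓡 4) P → Nonempty (P ≃ₘ⟮𝓡 4, 𝓡 4⟯ Metric.sphere (0 : EuclideanSpace ℝ (Fin 5)) 1)

end Literature.Topology.FourManifolds
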